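import Summits.ResolutionOfSingularities.ResolutionOfSingularities.Theorems.EquisingularLiftEquisingularLiftSectionBlowupFlatExceptionalCharts
import Literature.AlgebraicGeometry.Resolution.AffineBlowupUniversal
import Literature.AlgebraicGeometry.Resolution.RegularBlowup
import Literature.AlgebraicGeometry.Resolution.AlterationsLemma32
import Literature.AlgebraicGeometry.Resolution.BlowupsRelativeCartier
import Mathlib.AlgebraicGeometry.Morphisms.Smooth
import Mathlib.AlgebraicGeometry.Morphisms.ClosedImmersion
import HarnessLib

/-!
# `EquisingularLift`, line `strata-split` — the exceptional divisor of the blow-up along a regular flat centre is flat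

Crux `stmt-ResolutionOfSingularities-15660` = `Theses.EquisingularLift.EquisingularLift`; CURVE-CENTRE layer of the
blow-up calculus over a DVR (the `n = 3` stage of the line needs blow-ups of the `O`-ambient along regular `O`-flat
centres of relative dimension `1`, not only along sections). This file generalises the section case
`flat_exceptional_of_isBlowup_section` (`…SectionBlowupFlatExceptional`, centre `C = s(Spec O)`) to an ARBITRARY
regular centre flat over the base:

Setting: `O` any commutative ring, `U` a regular locally Noetherian scheme over `Spec O` (`r`), `K` an ideal sheaf on
`U` whose closed subscheme `C = V(K)` is regular and FLAT over `Spec O`, `τ : U' → U` a blow-up of `U` along `K`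
(universal property, `IsBlowup`). CLAIM (`flat_exceptional_of_isBlowup_regularCentre`): the exceptional divisor
`E = V(K · 𝒪_{U'}) → Spec O` is flat.

Proof (Liu, *Algebraic Geometry and Arithmetic Curves*, Thm. 8.1.19 (b), chartwise): flatness of `E → Spec O` is
local on `E` (`flat_subschemeι_comp_of_locally`: the pieces `V(K · 𝒪_V)` over opens `V ⊆ U'` are open subschemes of
`E`). At a point of `E` over `x ∈ C`, on an affine open `V = D(g) ∋ x` of `U` the ideal of `C` is generated by a
quasi-regular sequence `f` (`exists_isQuasiRegular_away_of_isRegularRing`, `U` and `C` being regular); over `V` the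
blow-up is the affine blow-up, whose exceptional divisor is chartwise the spectrum of a polynomial ring over
`Γ(C ∩ V)` — flat over `O` because `C → Spec O` is flat (`flat_exceptional_of_isBlowup_of_isAffine` of the charts
file); transport to `τ⁻¹(V) ⊆ U'`.

* `flat_subschemeι_comp_of_locally` — flatness of `V(K) → S` is local on the ambient scheme;
* `flat_exceptional_of_isBlowup_regularCentre` — the claim, for any base ring `O`;
* `flat_exceptional_of_isBlowup_regularCentre_of_smooth` — the form used by the line: `O` a DVR, `U → Spec O`
  smooth (hence `U` regular and locally Noetherian).

References: Q. Liu, *Algebraic Geometry and Arithmetic Curves*, OUP 2002, Thm. 8.1.19 (b); A. Grothendieck,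
J. Dieudonné, *EGA IV₄*, Publ. Math. IHÉS 32 (1967), Prop. 17.5.8 (iii), (19.4.2), (21.15.9).
-/

set_option linter.dupNamespace false -- mandated namespace `Summit.<Summit>.<Problem>` of this single-conjunct summit
set_option linter.overlappingInstances false -- the DVR form carries both [IsDomain O] and [IsDiscreteValuationRing O]

noncomputable section

open CategoryTheory CategoryTheory.Limits AlgebraicGeometry TopologicalSpace Topology
open Literature.AlgebraicGeometry.Resolution HomogeneousLocalization

namespace Summit.ResolutionOfSingularities.ResolutionOfSingularities.Cruxes.EquisingularLift.StrataSplit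

universe u

/-! ## Flatness of a closed subscheme over a base is local on the ambient scheme -/

/-- **Flatness of `V(K) → S` is local on `X`**: if every point of the support of `K` has an open neighbourhood
`V ⊆ X` such that `V(K · 𝒪_V) → S` is flat, then `V(K) → S` is flat. (The piece `V(K · 𝒪_V) = V ×_X V(K)` is an open
subscheme of `V(K)`, these pieces cover `V(K)`, and flatness is local on the source.) [folklore] -/
theorem flat_subschemeι_comp_of_locally {X S : Scheme.{u}} (K : X.IdealSheafData) (g : X ⟶ S)
    (h : ∀ x ∈ K.support, ∃ V : X.Opens, x ∈ V ∧ Flat ((K.comap V.ι).subschemeι ≫ V.ι ≫ g)) :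
    Flat (K.subschemeι ≫ g) := by
  have hmem : ∀ e : ↥K.subscheme, (K.subschemeι e : X) ∈ K.support := fun e => by
    rw [← SetLike.mem_coe, ← K.range_subschemeι]
    exact ⟨e, rfl⟩
  choose V hV hflat using fun e : ↥K.subscheme => h _ (hmem e)
  -- the open immersions `a e : V(K · 𝒪_{V e}) = V e ×_X V(K) → V(K)`
  let a : ∀ e : ↥K.subscheme, (K.comap (V e).ι).subscheme ⟶ K.subscheme := fun e =>
    (K.comapIso (V e).ι).hom ≫ pullback.snd (V e).ι K.subschemeι
  have ha : ∀ e, a e ≫ K.subschemeι = (K.comap (V e).ι).subschemeι ≫ (V e).ι := fun e => by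
    simp only [a, Category.assoc, ← pullback.condition, Scheme.IdealSheafData.comapIso_hom_fst_assoc]
  haveI : ∀ e, IsOpenImmersion (a e) := fun e => by
    simp only [a]; infer_instance
  have hrange : ∀ e, Set.range (a e) = (K.subschemeι ⁻¹ᵁ V e : Set ↥K.subscheme) := fun e => by
    simp only [a, Scheme.Hom.comp_base, TopCat.coe_comp]
    rw [Set.range_comp, Set.range_eq_univ.mpr (K.comapIso (V e).ι).hom.surjective, Set.image_univ,
      IsOpenImmersion.range_pullbackSnd, Scheme.Opens.opensRange_ι]
  -- they form an open cover of `V(K)`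
  let 𝒰 : (K.subscheme).OpenCover := Scheme.Cover.mkOfCovers (↥K.subscheme)
    (fun e => (K.comap (V e).ι).subscheme) a (fun e => by
      have he : e ∈ Set.range (a e) := by rw [hrange e]; exact hV e
      obtain ⟨y, hy⟩ := he
      exact ⟨e, y, hy⟩)
  refine IsZariskiLocalAtSource.of_openCover 𝒰 fun e => ?_
  show Flat (a e ≫ K.subschemeι ≫ g)
  rw [← Category.assoc, ha e, Category.assoc]
  exact hflat e

/-! ## The exceptional divisor of the blow-up along a regular flat centre -/

/-- **The exceptional divisor of the blow-up along a regular centre flat over the base is flat over the base**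
(Liu, Thm. 8.1.19 (b): chart by chart the exceptional divisor is an affine space over the centre). Let `O` be a
commutative ring, `U` a regular locally Noetherian scheme with `r : U → Spec O`, `K` an ideal sheaf on `U` with
`V(K)` regular and `V(K) → Spec O` flat, and `τ : U' → U` a blow-up of `U` along `K`. Then
`V(K · 𝒪_{U'}) → Spec O` is flat. [cite: Liu2002, Thm. 8.1.19 (b)] -/
theorem flat_exceptional_of_isBlowup_regularCentre : ∀ (O : Type) [CommRing O] (U U' : AlgebraicGeometry.Scheme.{0}) [AlgebraicGeometry.IsLocallyNoetherian U] (r : U ⟶ AlgebraicGeometry.Spec (.of O)) (K : U.IdealSheafData), Literature.AlgebraicGeometry.Resolution.Scheme.IsRegular U → Literature.AlgebraicGeometry.Resolution.Scheme.IsRegular K.subscheme → AlgebraicGeometry.Flat (CategoryTheory.CategoryStruct.comp K.subschemeι r) → ∀ (τ : U' ⟶ U), Literature.AlgebraicGeometry.Resolution.IsBlowup τ K → AlgebraicGeometry.Flat (CategoryTheory.CategoryStruct.comp (K.comap τ).subschemeι (CategoryTheory.CategoryStruct.comp τ r)) := by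
  intro O _ U U' _ r K hUreg hZreg hflat0 τ hτ
  haveI := hflat0
  -- flatness is local on `U'`: work at a point `z` of the exceptional locus, over `x₀ = τ z ∈ V(K)`
  refine flat_subschemeι_comp_of_locally (K.comap τ) (τ ≫ r) fun z hz => ?_
  set x₀ : U := τ z with hx₀
  have hxs : x₀ ∈ K.support := by
    rw [Scheme.IdealSheafData.support_comap] at hz
    exact hz
  -- (1) an affine open `W ∋ x₀`; `A = Γ(U, W)` and `A/I(W)` are regular rings
  -- adapted from `flat_exceptional_of_isBlowup_section` (section case, same line)
  obtain ⟨W, hW, hxW, -⟩ := exists_isAffineOpen_mem_and_subset (X := U) (x := x₀) (U := ⊤) (Opens.mem_top _)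
  haveI : IsNoetherianRing Γ(U, W) := IsLocallyNoetherian.component_noetherian ⟨W, hW⟩
  haveI : IsRegularRing Γ(U, W) := hUreg.isRegularRing_of_isAffineOpen hW
  set I : Ideal Γ(U, W) := K.ideal ⟨W, hW⟩ with hI
  haveI : IsRegularRing (Γ(U, W) ⧸ I) := by
    have hreg : Scheme.IsRegular (Spec (K.subschemeCover.X ⟨W, hW⟩)) :=
      Scheme.IsRegular.of_isOpenImmersion (K.subschemeCover.f ⟨W, hW⟩) hZreg
    exact (Scheme.isRegular_Spec_iff (.of (Γ(U, W) ⧸ I))).mp hreg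
  -- the prime `𝔭` of `x₀` and `I ⊆ 𝔭`
  have hmemD : ∀ g : Γ(U, W), x₀ ∈ U.basicOpen g ↔ g ∉ (hW.primeIdealOf ⟨x₀, hxW⟩).asIdeal := by
    intro g
    rw [← PrimeSpectrum.mem_basicOpen, ← hW.fromSpec_preimage_basicOpen g]
    change _ ↔ hW.fromSpec (hW.primeIdealOf ⟨x₀, hxW⟩) ∈ U.basicOpen g
    rw [hW.fromSpec_primeIdealOf ⟨x₀, hxW⟩]
  have hIp : I ≤ (hW.primeIdealOf ⟨x₀, hxW⟩).asIdeal := by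
    intro f hf
    have hz' := (Scheme.IdealSheafData.mem_support_iff_of_mem (I := K) (U := ⟨W, hW⟩) hxW).mp hxs
    rw [Scheme.mem_zeroLocus_iff] at hz'
    by_contra hfp
    exact hz' f hf ((hmemD f).mpr hfp)
  -- (2) the local structure theorem: on a basic open `D(g) ∋ x₀` the centre is cut out by a quasi-regular sequence
  obtain ⟨g, hgp, c, f, -, hloc⟩ := exists_isQuasiRegular_away_of_isRegularRing I _ hIp
  have hxg : x₀ ∈ U.basicOpen g := (hmemD g).mpr hgp
  set V : U.Opens := U.basicOpen g with hV
  have hVaff : IsAffineOpen V := hW.basicOpen g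
  haveI : IsAffine (V : Scheme.{0}) := hVaff
  -- `Γ(V, ⊤) = Γ(U, V.ι '' ⊤)` as a `Γ(U, W)`-algebra: a localisation away from `g`
  have hle : V.ι ''ᵁ ⊤ ≤ W := by rw [Scheme.Opens.ι_image_top]; exact U.basicOpen_le g
  letI alg : Algebra Γ(U, W) Γ((V : Scheme.{0}), ⊤) :=
    (U.presheaf.map (homOfLE hle).op).hom.toAlgebra
  haveI hlocV : IsLocalization.Away g Γ((V : Scheme.{0}), ⊤) := by
    haveI := hW.isLocalization_basicOpen g
    refine IsLocalization.isLocalization_of_algEquiv (Submonoid.powers g)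
      (AlgEquiv.ofRingEquiv (f := V.topIso.symm.commRingCatIsoToRingEquiv) fun a => ?_)
    have hcomp : U.presheaf.map (homOfLE (U.basicOpen_le g)).op ≫ V.topIso.inv =
        U.presheaf.map (homOfLE hle).op := by
      rw [Scheme.Opens.topIso_inv]
      exact ((U.presheaf.map_comp _ _).symm.trans (by rfl))
    exact congrArg (fun φ : Γ(U, W) ⟶ Γ((V : Scheme.{0}), ⊤) => φ.hom a) hcomp
  obtain ⟨hIL, hqr, -, -⟩ := hloc Γ((V : Scheme.{0}), ⊤)
  -- the ideal of `K|_V` on the affine scheme `V`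
  have hJV : (K.comap V.ι).ideal ⟨⊤, isAffineOpen_top _⟩ =
      Ideal.span (Set.range (algebraMap Γ(U, W) Γ((V : Scheme.{0}), ⊤) ∘ f)) := by
    rw [← hIL, Scheme.IdealSheafData.ideal_comap_of_isOpenImmersion, Scheme.Opens.ι_appIso,
      Iso.refl_inv]
    have hWV : K.ideal ⟨V.ι ''ᵁ ⊤, (isAffineOpen_top (V : Scheme.{0})).image_of_isOpenImmersion V.ι⟩ =
        I.map (U.presheaf.map (homOfLE hle).op).hom :=
      (K.map_ideal (U := ⟨V.ι ''ᵁ ⊤, _⟩) (V := ⟨W, hW⟩) hle).symm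
    rw [hWV]
    change (I.map _).comap (RingHom.id _) = _
    rw [Ideal.comap_id]
    rfl
  -- (3) `V(K) ∩ V → Spec O` is flat, hence `Γ(V, ⊤)/(f)` is a flat `O`-module
  set q : (V : Scheme.{0}) ⟶ Spec (.of O) := V.ι ≫ r with hqdef
  haveI hflatV : Flat ((K.comap V.ι).subschemeι ≫ q) := flat_comap_subschemeι_comp V.ι K r
  have hθflat : ((Ideal.Quotient.mk (Ideal.span (Set.range (algebraMap Γ(U, W) Γ((V : Scheme.{0}), ⊤) ∘ f)))).comp
      ((Scheme.ΓSpecIso (.of O)).inv ≫ q.appTop).hom).Flat := by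
    letI algO : Algebra O Γ((V : Scheme.{0}), ⊤) := ((Scheme.ΓSpecIso (.of O)).inv ≫ q.appTop).hom.toAlgebra
    have hq : (isAffineOpen_top (V : Scheme.{0})).fromSpec ≫ q =
        Spec.map (CommRingCat.ofHom (algebraMap O Γ((V : Scheme.{0}), ⊤))) := by
      rw [IsAffineOpen.fromSpec_top, RingHom.algebraMap_toAlgebra, CommRingCat.ofHom_hom, Iso.inv_comp_eq]
      exact eq_toSpecΓ_SpecMap q
    have hM := moduleFlat_quotient_of_flat_subschemeι (K := K.comap V.ι) q ⟨⊤, isAffineOpen_top _⟩ hq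
    rw [hJV] at hM
    have hM' := RingHom.flat_algebraMap_iff.mpr hM
    have halg : algebraMap O (Γ((V : Scheme.{0}), ⊤) ⧸
        Ideal.span (Set.range (algebraMap Γ(U, W) Γ((V : Scheme.{0}), ⊤) ∘ f))) =
        (Ideal.Quotient.mk _).comp ((Scheme.ΓSpecIso (.of O)).inv ≫ q.appTop).hom :=
      RingHom.ext fun _ => rfl
    rw [halg] at hM'
    exact hM'
  -- (4) the blow-up restricted over `V` is a blow-up of the affine scheme `V`; its exceptional divisor is flat
  have hτV : IsBlowup (τ ∣_ V) (K.comap V.ι) := hτ.restrict V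
  haveI hflatE : Flat ((((K.comap V.ι).comap (τ ∣_ V)).subschemeι) ≫ (τ ∣_ V) ≫ q) :=
    flat_exceptional_of_isBlowup_of_isAffine _ _ (K.comap V.ι) _ _ hJV hqr _ hτV O q hθflat
  -- (5) transport to the open `τ⁻¹(V) ∋ z` of `U'`
  have hK : (K.comap τ).comap (τ ⁻¹ᵁ V).ι = (K.comap V.ι).comap (τ ∣_ V) := by
    rw [← Scheme.IdealSheafData.comap_comp, ← Scheme.IdealSheafData.comap_comp, morphismRestrict_ι]
  have hm : (τ ⁻¹ᵁ V).ι ≫ τ ≫ r = (τ ∣_ V) ≫ q := by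
    rw [hqdef, ← morphismRestrict_ι_assoc]
  refine ⟨τ ⁻¹ᵁ V, hxg, ?_⟩
  rw [hK, hm]
  exact hflatE

/-- **The same over a DVR with smooth ambient** (the form used by the line `strata-split`): `O` a discrete valuation
ring, `r : U → Spec O` smooth, `K` an ideal sheaf on `U` with `V(K)` regular and flat over `Spec O`, `τ : U' → U` a
blow-up along `K`; then `V(K · 𝒪_{U'}) → Spec O` is flat. (`U` is regular, being smooth over the regular scheme
`Spec O` — EGA IV₄ 17.5.8 (iii) — and locally Noetherian.) [cite: Liu2002, Thm. 8.1.19 (b)] -/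
theorem flat_exceptional_of_isBlowup_regularCentre_of_smooth : ∀ (O : Type) [CommRing O] [IsDomain O] [IsDiscreteValuationRing O] (U U' : AlgebraicGeometry.Scheme.{0}) (r : U ⟶ AlgebraicGeometry.Spec (.of O)) [AlgebraicGeometry.Smooth r] (K : U.IdealSheafData), Literature.AlgebraicGeometry.Resolution.Scheme.IsRegular K.subscheme → AlgebraicGeometry.Flat (CategoryTheory.CategoryStruct.comp K.subschemeι r) → ∀ (τ : U' ⟶ U), Literature.AlgebraicGeometry.Resolution.IsBlowup τ K → AlgebraicGeometry.Flat (CategoryTheory.CategoryStruct.comp (K.comap τ).subschemeι (CategoryTheory.CategoryStruct.comp τ r)) := by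
  intro O _ _ _ U U' r _ K hZreg hflat0 τ hτ
  haveI : IsLocallyNoetherian U := LocallyOfFiniteType.isLocallyNoetherian r
  haveI hO : IsRegularRing (CommRingCat.of O) := inferInstanceAs (IsRegularRing O)
  have hUreg : Scheme.IsRegular U := Scheme.IsRegular.of_smooth r (Scheme.isRegular_Spec (.of O))
  exact flat_exceptional_of_isBlowup_regularCentre O U U' r K hUreg hZreg hflat0 τ hτ

end Summit.ResolutionOfSingularities.ResolutionOfSingularities.Cruxes.EquisingularLift.StrataSplit

end
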